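import Mathlib.Data.Real.Basic
import Mathlib.Algebra.BigOperators.Ring.Finset
import Mathlib.Algebra.Order.BigOperators.Group.Finset
import Mathlib.Data.Fintype.BigOperators
import HarnessLib

/-!
# LP certificates: from an exact dual solution to a proved linear bound

HONEST FRAMING. Part of the venture `Summits/Ventures/Crystal3D` (cell `pub-crystal3d`). This file
is the generic, fully proved half of the "LP-certificate → theorem" bridge: it turns an EXACT
(rational) dual certificate of a finite linear programme into a Lean inequality, by weak duality.
It knows nothing about spheres; the geometric local inequalities that feed it are hypotheses of
the instantiation file (`LocalLP/ContactBridge.lean`). No claim about crystallization is made.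

## The shape (chosen to match the cell's LP lane)

Primal data, all integer (pre-scaled rational) and finite:
* variables `q : Fin n → ℝ` — in the application, `q τ` = number of balls whose local type is `τ`
  (e.g. `τ` = coordination number `0, …, 12`);
* parameters `p : Fin r → ℝ` with `p ≥ 0` — in the application `p = (N, S, …)`: the number of
  balls and global "resource" lower bounds (e.g. total exposed cap area `≥ 15.159805 · N^{2/3}`
  in Bezdek–Reid's argument), entering the right-hand sides LINEARLY;
* rows `i : Fin m`: `∑ j, A i j * q j ≤ ∑ k, B i k * p k` (equalities = two rows; `q ≥ 0` = rows);
* objective `∑ j, c j * q j` (e.g. `½ ∑ τ, τ · q τ` = the contact number) and a claimed bound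
  `∑ k, D k * p k` (e.g. `6 N - γ S`).

Certificate: INTEGER data (rows pre-scaled), multipliers `y : Fin m → ℕ` and a scale `L > 0` with
`yᵀA = L • c` and `yᵀB ≤ L • D` componentwise (`LPCert.Valid`, a DECIDABLE proposition: a
concrete certificate is checked by `decide` in the kernel — integer arithmetic only). Weak duality (`LPCert.sound`): every feasible `(q, p)` with `p ≥ 0` satisfies
`∑ c j q j ≤ ∑ D k p k`. Variant `LPCert.sound_of_nonneg` for sign-constrained variables
(`q ≥ 0`, certificate condition relaxed to `yᵀA ≥ c`).

Counting glue (`typeCount`, `sum_typeCount`, `sum_comp_eq_sum_typeCount_mul`): when balls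
`i : Fin N` carry types `t i : Fin n`, per-ball quantities that depend only on the type sum to
`∑ τ, (#balls of type τ) · value τ` — this is how per-ball local inequalities become the rows above.

## References (for the method; nothing vendored)

* Weak LP duality / Farkas: any text, e.g. Schrijver, *Theory of Linear and Integer Programming*
  (1986), §7.
* The Flyspeck pattern (local inequalities + linear relaxation with exact certificates):
  T. C. Hales, *Dense Sphere Packings: A Blueprint for Formal Proofs* (2012), §7–8.
* K. Bezdek, S. Reid, *Contact graphs of unit sphere packings revisited*, J. Geom. 104 (2013)
  57–83, arXiv:1210.5756, §2 (the three-type contact LP behind `C(n) < 6n - 0.926 n^{2/3}`).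
-/

open scoped BigOperators
open Finset

namespace Summit.Ventures.Crystal3D.LocalLP

/-! ## Certificates -/

/-- An **LP dual certificate** with parametric right-hand sides, all data INTEGER (rows and
multipliers are pre-scaled by the certificate producer; exact rational certificates clear
denominators row by row): `m` rows `∑ j, A i j * q j ≤ ∑ k, B i k * p k` in variables
`q : Fin n → ℝ` and non-negative parameters `p : Fin r → ℝ`, objective `∑ j, c j * q j`, claimed
bound `∑ k, D k * p k`, non-negative dual multipliers `y : Fin m → ℕ` and a positive objective
scale `scale` (`yᵀA = scale • c`, `yᵀB ≤ scale • D`). Integer data keeps `Valid` decidable by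
`decide` in the kernel (no rational normalisation). -/
structure LPCert (m n r : ℕ) where
  /-- constraint matrix (rows × variables) -/
  A : Fin m → Fin n → ℤ
  /-- right-hand-side coefficients (rows × parameters) -/
  B : Fin m → Fin r → ℤ
  /-- objective coefficients -/
  c : Fin n → ℤ
  /-- bound coefficients (on the parameters) -/
  D : Fin r → ℤ
  /-- dual multipliers, one per row (non-negative by type) -/
  y : Fin m → ℕ
  /-- positive scale of the objective: the multipliers certify `scale • (objective ≤ bound)` -/
  scale : ℕ

namespace LPCert

variable {m n r : ℕ} (P : LPCert m n r)

/-- **Validity of a certificate** (exact integer arithmetic, decidable): the scale is positive,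
the multipliers reproduce the scaled objective (`yᵀA = scale • c`), and their right-hand-side
combination is dominated by the scaled bound (`yᵀB ≤ scale • D` componentwise). -/
def Valid : Prop :=
  0 < P.scale ∧ (∀ j, ∑ i, (P.y i : ℤ) * P.A i j = P.scale * P.c j) ∧
    (∀ k, ∑ i, (P.y i : ℤ) * P.B i k ≤ P.scale * P.D k)

/-- `Valid` is decidable (integer arithmetic over finite index types). -/
instance : Decidable P.Valid := by
  unfold Valid; infer_instance

/-- **Validity for sign-constrained variables**: as `Valid` but only `yᵀA ≥ scale • c` (sound
when the primal variables are known to be non-negative, `sound_of_nonneg`). -/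
def ValidGE : Prop :=
  0 < P.scale ∧ (∀ j, (P.scale : ℤ) * P.c j ≤ ∑ i, (P.y i : ℤ) * P.A i j) ∧
    (∀ k, ∑ i, (P.y i : ℤ) * P.B i k ≤ P.scale * P.D k)

/-- `ValidGE` is decidable (integer arithmetic over finite index types). -/
instance : Decidable P.ValidGE := by
  unfold ValidGE; infer_instance

/-- A valid certificate is valid in the relaxed sense. -/
theorem Valid.validGE {P : LPCert m n r} (h : P.Valid) : P.ValidGE :=
  ⟨h.1, fun j => (h.2.1 j).ge, h.2.2⟩

/-- **Feasibility** of a real point `(q, p)`: every row holds. -/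
def Feasible (q : Fin n → ℝ) (p : Fin r → ℝ) : Prop :=
  ∀ i, ∑ j, (P.A i j : ℝ) * q j ≤ ∑ k, (P.B i k : ℝ) * p k

/-- The dual combination of the rows: `∑ i, y i · (row i)` gives
`∑ j (yᵀA) j q j ≤ ∑ k (yᵀB) k p k` (over `ℝ`). -/
theorem dual_combination {q : Fin n → ℝ} {p : Fin r → ℝ} (hq : P.Feasible q p) :
    ∑ j, (∑ i, (P.y i : ℝ) * P.A i j) * q j ≤ ∑ k, (∑ i, (P.y i : ℝ) * P.B i k) * p k := by
  calc ∑ j, (∑ i, (P.y i : ℝ) * P.A i j) * q j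
      = ∑ i, (P.y i : ℝ) * ∑ j, (P.A i j : ℝ) * q j := by
        simp_rw [sum_mul, mul_sum, mul_assoc]
        rw [sum_comm]
    _ ≤ ∑ i, (P.y i : ℝ) * ∑ k, (P.B i k : ℝ) * p k :=
        sum_le_sum fun i _ => mul_le_mul_of_nonneg_left (hq i) (Nat.cast_nonneg _)
    _ = ∑ k, (∑ i, (P.y i : ℝ) * P.B i k) * p k := by
        simp_rw [sum_mul, mul_sum, mul_assoc]
        rw [sum_comm]

/-- Cast of the integer identity `yᵀA = scale • c` to `ℝ`. -/
theorem cast_yA_eq {j : Fin n} (h : ∑ i, (P.y i : ℤ) * P.A i j = P.scale * P.c j) :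
    ∑ i, (P.y i : ℝ) * P.A i j = (P.scale : ℝ) * P.c j := by
  have h' := congrArg (fun z : ℤ => (z : ℝ)) h
  simpa [Int.cast_sum, Int.cast_mul, Int.cast_natCast] using h'

/-- Cast of the integer inequality `scale • c ≤ yᵀA` to `ℝ`. -/
theorem cast_le_yA {j : Fin n} (h : (P.scale : ℤ) * P.c j ≤ ∑ i, (P.y i : ℤ) * P.A i j) :
    (P.scale : ℝ) * P.c j ≤ ∑ i, (P.y i : ℝ) * P.A i j := by
  have h' := (Int.cast_le (R := ℝ)).2 h
  simpa [Int.cast_sum, Int.cast_mul, Int.cast_natCast] using h'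

/-- Cast of the integer inequality `yᵀB ≤ scale • D` to `ℝ`. -/
theorem cast_yB_le {k : Fin r} (h : ∑ i, (P.y i : ℤ) * P.B i k ≤ P.scale * P.D k) :
    ∑ i, (P.y i : ℝ) * P.B i k ≤ (P.scale : ℝ) * P.D k := by
  have h' := (Int.cast_le (R := ℝ)).2 h
  simpa [Int.cast_sum, Int.cast_mul, Int.cast_natCast] using h'

/-- **Weak duality, sign-constrained variables.** If the relaxed certificate is valid then every
feasible point with `q ≥ 0`, `p ≥ 0` satisfies the claimed bound `∑ j, c j * q j ≤ ∑ k, D k * p k`.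
-/
theorem sound_of_nonneg (hP : P.ValidGE) {q : Fin n → ℝ} {p : Fin r → ℝ} (hq0 : ∀ j, 0 ≤ q j)
    (hp : ∀ k, 0 ≤ p k) (hq : P.Feasible q p) :
    ∑ j, (P.c j : ℝ) * q j ≤ ∑ k, (P.D k : ℝ) * p k := by
  obtain ⟨hs, hA, hB⟩ := hP
  have hs' : (0 : ℝ) < P.scale := by exact_mod_cast hs
  have key : (P.scale : ℝ) * ∑ j, (P.c j : ℝ) * q j ≤ (P.scale : ℝ) * ∑ k, (P.D k : ℝ) * p k :=
    calc (P.scale : ℝ) * ∑ j, (P.c j : ℝ) * q j = ∑ j, ((P.scale : ℝ) * P.c j) * q j := by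
          rw [mul_sum]; simp_rw [mul_assoc]
      _ ≤ ∑ j, (∑ i, (P.y i : ℝ) * P.A i j) * q j :=
          sum_le_sum fun j _ => mul_le_mul_of_nonneg_right (P.cast_le_yA (hA j)) (hq0 j)
      _ ≤ ∑ k, (∑ i, (P.y i : ℝ) * P.B i k) * p k := P.dual_combination hq
      _ ≤ ∑ k, ((P.scale : ℝ) * P.D k) * p k :=
          sum_le_sum fun k _ => mul_le_mul_of_nonneg_right (P.cast_yB_le (hB k)) (hp k)
      _ = (P.scale : ℝ) * ∑ k, (P.D k : ℝ) * p k := by rw [mul_sum]; simp_rw [mul_assoc]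
  exact le_of_mul_le_mul_left key hs'

/-- **Weak duality (soundness of a valid certificate).** If the certificate is valid then every
feasible point with non-negative parameters satisfies the claimed bound:
`∑ j, c j * q j ≤ ∑ k, D k * p k` — no sign assumption on the variables `q`. This is the
kernel-checked step "exact LP certificate ⇒ theorem". -/
theorem sound (hP : P.Valid) {q : Fin n → ℝ} {p : Fin r → ℝ} (hp : ∀ k, 0 ≤ p k)
    (hq : P.Feasible q p) :
    ∑ j, (P.c j : ℝ) * q j ≤ ∑ k, (P.D k : ℝ) * p k := by
  obtain ⟨hs, hA, hB⟩ := hP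
  have hs' : (0 : ℝ) < P.scale := by exact_mod_cast hs
  have key : (P.scale : ℝ) * ∑ j, (P.c j : ℝ) * q j ≤ (P.scale : ℝ) * ∑ k, (P.D k : ℝ) * p k :=
    calc (P.scale : ℝ) * ∑ j, (P.c j : ℝ) * q j = ∑ j, ((P.scale : ℝ) * P.c j) * q j := by
          rw [mul_sum]; simp_rw [mul_assoc]
      _ = ∑ j, (∑ i, (P.y i : ℝ) * P.A i j) * q j := by simp_rw [P.cast_yA_eq (hA _)]
      _ ≤ ∑ k, (∑ i, (P.y i : ℝ) * P.B i k) * p k := P.dual_combination hq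
      _ ≤ ∑ k, ((P.scale : ℝ) * P.D k) * p k :=
          sum_le_sum fun k _ => mul_le_mul_of_nonneg_right (P.cast_yB_le (hB k)) (hp k)
      _ = (P.scale : ℝ) * ∑ k, (P.D k : ℝ) * p k := by rw [mul_sum]; simp_rw [mul_assoc]
  exact le_of_mul_le_mul_left key hs'

end LPCert

/-! ## Counting glue: per-ball quantities that depend only on a finite type -/

section Counting

variable {N n : ℕ}

/-- The number of balls of type `τ` under a type assignment `t : Fin N → Fin n`. -/
def typeCount (t : Fin N → Fin n) (τ : Fin n) : ℕ :=
  (univ.filter fun i => t i = τ).card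

/-- The type counts sum to the number of balls: `∑ τ, #{i | t i = τ} = N`. -/
theorem sum_typeCount (t : Fin N → Fin n) : ∑ τ, typeCount t τ = N := by
  unfold typeCount
  rw [← card_eq_sum_card_fiberwise (s := univ) (t := univ) (fun i _ => mem_univ (t i))]
  simp

/-- **Summation by type.** A per-ball quantity that depends only on the type sums to
`∑ τ, (count τ) · value τ`. -/
theorem sum_comp_eq_sum_typeCount_mul (t : Fin N → Fin n) (v : Fin n → ℝ) :
    ∑ i, v (t i) = ∑ τ, (typeCount t τ : ℝ) * v τ := by
  unfold typeCount
  rw [← sum_fiberwise_of_maps_to (s := univ) (t := univ) (g := t) (fun i _ => mem_univ (t i))]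
  refine sum_congr rfl fun τ _ => ?_
  have h : ∀ i ∈ univ.filter (fun i => t i = τ), v (t i) = v τ := fun i hi => by
    rw [(mem_filter.1 hi).2]
  rw [sum_congr rfl h, sum_const, nsmul_eq_mul]

/-- **Per-ball local inequalities aggregate by type.** If every ball `i` satisfies
`f i ≤ a (t i)` (a local inequality whose bound depends only on the type) then
`∑ i, f i ≤ ∑ τ, (count τ) · a τ`. -/
theorem sum_le_sum_typeCount_mul (t : Fin N → Fin n) {f : Fin N → ℝ} {a : Fin n → ℝ}
    (h : ∀ i, f i ≤ a (t i)) : ∑ i, f i ≤ ∑ τ, (typeCount t τ : ℝ) * a τ := by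
  rw [← sum_comp_eq_sum_typeCount_mul]
  exact sum_le_sum fun i _ => h i

/-- … and dually `∑ τ, (count τ) · a τ ≤ ∑ i, f i` when `a (t i) ≤ f i` for every ball. -/
theorem sum_typeCount_mul_le_sum (t : Fin N → Fin n) {f : Fin N → ℝ} {a : Fin n → ℝ}
    (h : ∀ i, a (t i) ≤ f i) : ∑ τ, (typeCount t τ : ℝ) * a τ ≤ ∑ i, f i := by
  rw [← sum_comp_eq_sum_typeCount_mul]
  exact sum_le_sum fun i _ => h i

end Counting

/-! ## Sanity check: a two-variable toy certificate is accepted by `decide`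

`max q₀ + q₁` subject to `q₀ ≤ p₀`, `q₁ ≤ p₀`, multipliers `y = (1, 1)`, bound `2 p₀`. -/

/-- A toy certificate (two variables, one parameter), used only to exercise `decide` on
`LPCert.Valid`. -/
def toyCert : LPCert 2 2 1 where
  A := fun i j => if (i : ℕ) = (j : ℕ) then 1 else 0
  B := fun _ _ => 1
  c := fun _ => 1
  D := fun _ => 2
  y := fun _ => 1
  scale := 1

/-- The toy certificate is valid (checked by `decide` in the kernel). -/
theorem toyCert_valid : toyCert.Valid := by
  unfold toyCert LPCert.Valid
  decide

end Summit.Ventures.Crystal3D.LocalLP
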